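import Literature.NumberTheory.EllipticCurves.ShaRestrictionJZeroDescent
import Literature.NumberTheory.EllipticCurves.LocalRestrictionDegree
import HarnessLib

/-!
# Exact local descent of `Ш` along `K(ω)/K` for `j = 0` short models

For an elliptic curve `E : y² = x³ + B` over a field `K` of characteristic `0` (all of
`a₁, …, a₄` zero) and a tower of `K`-fields `K → E → E'` with `E' = E + E ζ` for a primitive cube
root of unity `ζ ∈ E'` (so `[E' : E] ≤ 2`), a class of `H¹(K, E)` that dies in `H¹(E', E)` already
dies in `H¹(E, E)` (`JZero.mem_localRestrictionKer_of_tower`): the converse of the tree's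
`localRestrictionKer_le_of_tower` WITHOUT the factor `2` of
`two_nsmul_mem_localRestrictionKer_of_tower`. The kernel of `H¹(E, E) → H¹(E', E)` is inflated from
`Gal(E'/E)` (`resKer_le_range_inflClass`), of order `≤ 2` and generated by an element `g₀` acting on
the embedded cube root by `ζ ↦ ζ²`; the value `P = f g₀` of an inflated crossed homomorphism is then
flipped by `g₀`, and `Q = [ω] P = (ζ² x_P, y_P)` is a coboundary witness
(`JZero.exists_cm_coboundary_witness_map`, the trace identity `[ω²] + [ω] + 1 = 0` of
`horizontal_some_add_some_eq_neg`), so the class vanishes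
(`inflClass_eq_zero_of_index_two_of_witness`). In words: `H¹(Gal(E'/E), E(E')) = 0` because
`E(E')` is a `ℤ[ω]`-module on which the generator acts semilinearly and `ω` has trace `−1`.

Applied at every completion of a number field `L = K + K ω ⊇ K` (`ω² + ω + 1 = 0`; at a finite
place `w ∣ v` one has `L_w = K_v + K_v ω` because `K_v + K_v ω` is a closed `K_v`-subspace containing
the dense image of `L`; at an infinite place either `L_w = K_v` or `K_v ≅ ℝ` contains no primitive
cube root of unity), this gives the EXACT LOCAL DESCENT

* `JZero.mem_sha_of_resBaseChange_mem_sha` — `res x ∈ Ш(E_L/L) ⇒ x ∈ Ш(E/K)` for `x ∈ H¹(K, E)`;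
* `JZero.mem_sha_iff_resBaseChange_mem_sha` — `x ∈ Ш(E/K) ⇔ res x ∈ Ш(E_L/L)`;
* `JZero.mem_sha_of_resBaseChange_mem_sha_rat` — the case `K = ℚ`, `L` a quadratic number field
  containing `ω` (`L ≅ ℚ(√−3)`, the frame of the cube-sum curves),

complementing the injectivity `Ш(E/ℚ) ↪ Ш(E_L/L)` of `ShaRestrictionJZeroDescent`: together,
`Ш(E/ℚ) = res⁻¹ Ш(E_L/L)` inside `H¹(ℚ, E) ↪ H¹(L, E_L)`. Everything here is proved; no new
definitions.

## References

* J.-P. Serre, *Galois Cohomology* (1997), I.§2.4 (Prop. 9 and Cor.), I.§5.8, II.§1.1.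
  [SerreGaloisCohomology1997]
* J. H. Silverman, *The Arithmetic of Elliptic Curves*, 2nd ed. (2009), III.10.1, X.4.
  [SilvermanAEC2009]
* J. S. Milne, *Arithmetic Duality Theorems*, 2nd ed. (2006), I.§6. [MilneADT2006]
* B. H. Gross, Kolyvagin's work on modular elliptic curves, LMS Lect. Notes 153 (1991), §5 (5.1).
  [GrossLMS1991]
-/

noncomputable section

open scoped Classical

universe u

namespace Literature.NumberTheory.EllipticCurves

open GaloisRepresentations WeierstrassCurve IntermediateField

/-! ## §1 The coboundary witness `Q = [ω]P` on `E(Ω)` for the coordinatewise action of `Aut(Ω/k)` -/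

namespace JZero

section MapWitness

variable {k : Type u} [Field k] (V : WeierstrassCurve k) [V.IsElliptic]
variable {Ω : Type u} [Field Ω] [Algebra k Ω]

omit [V.IsElliptic] in
/-- `Point.map s` is coordinatewise on affine points (Mathlib `Affine.Point.map_some`,
definitionally). Silverman, *AEC*, VIII.§1. [folklore] -/
private theorem map_some_eq (s : Ω →ₐ[k] Ω) {x y : Ω}
    (h : (V.baseChange Ω).toAffine.Nonsingular x y) :
    ∃ h', Affine.Point.map (W' := V) s (Affine.Point.some x y h) = Affine.Point.some (s x) (s y) h' :=
  ⟨_, rfl⟩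

/-- On an elliptic `j = 0` short model `y² = x³ + B` (all of `a₁, …, a₄` zero) every solution of
the equation over a field `Ω ⊇ k` is a nonsingular point, and the equation is stable under
`(x, y) ↦ (ζ'x, y)` for `ζ'³ = 1` and under `y ↦ −y`. Silverman, *AEC*, III.1 and III.10.1.
[folklore] -/
private theorem nonsingular_cubeRoot_mul_map (ha₁ : V.a₁ = 0) (ha₂ : V.a₂ = 0) (ha₃ : V.a₃ = 0)
    (ha₄ : V.a₄ = 0) {ζ' : Ω} (hζ'3 : ζ' ^ 3 = 1) {x y : Ω}
    (h : (V.baseChange Ω).toAffine.Nonsingular x y) (n : ℕ) (ε : ℤˣ) :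
    (V.baseChange Ω).toAffine.Nonsingular (ζ' ^ n * x) ((ε : ℤ) • y) := by
  haveI : (V.baseChange Ω).IsElliptic := by
    rw [WeierstrassCurve.baseChange]; infer_instance
  have hb₁ : (V.baseChange Ω).a₁ = 0 := by simp [WeierstrassCurve.baseChange, ha₁]
  have hb₂ : (V.baseChange Ω).a₂ = 0 := by simp [WeierstrassCurve.baseChange, ha₂]
  have hb₃ : (V.baseChange Ω).a₃ = 0 := by simp [WeierstrassCurve.baseChange, ha₃]
  have hb₄ : (V.baseChange Ω).a₄ = 0 := by simp [WeierstrassCurve.baseChange, ha₄]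
  rw [← Affine.equation_iff_nonsingular] at h ⊢
  rw [Affine.equation_iff'] at h ⊢
  simp only [hb₁, hb₂, hb₃, hb₄, zero_mul, add_zero] at h ⊢
  have hε : ((ε : ℤ) : Ω) ^ 2 = 1 := by
    rcases Int.units_eq_one_or ε with rfl | rfl <;> simp
  have hζn : (ζ' ^ n) ^ 3 = 1 := by rw [← pow_mul, mul_comm, pow_mul, hζ'3, one_pow]
  rw [zsmul_eq_mul]
  linear_combination h + y ^ 2 * hε - x ^ 3 * hζn

/-- **The coboundary witness `Q = [ω]P`, coordinatewise form.** `E = V/k` elliptic with all of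
`a₁, …, a₄` zero (`y² = x³ + B`), `Ω ⊇ k` a field of characteristic `0`, `ζ' ∈ Ω` a primitive
cube root of unity, `P ∈ E(Ω)`, and `k`-algebra endomorphisms `s` of `Ω` acting coordinatewise
(`Affine.Point.map s`). Then `Q := (ζ'²x_P, y_P)` (`Q := O` for `P = O`) satisfies: (i) `s Q = Q`
whenever `s ζ' = ζ'` and `s P = P`; (ii) `s Q − Q = P` whenever `s ζ' = ζ'²` and `s P = −P` — since
`s Q = (ζ'⁴x, −y) = (ζ'x, −y)` and `(ζ'x, −y) + (ζ'²x, −y) = −(x, −y) = P`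
(`horizontal_some_add_some_eq_neg`, the trace identity `[ω²] + [ω] + 1 = 0`). This is
`ShaRestrictionJZeroDescent`'s `JZero.exists_cm_coboundary_witness` for an arbitrary coefficient
field `Ω` in place of `ℚ̄` (used below with `Ω = Ē` for a completion `E = K_v`).
Silverman, *AEC*, III.10.1 (`Aut E ≅ μ₆` for `j = 0`).
[cite: SilvermanAEC2009, Thm. III.10.1 and Cor. III.10.2] -/
theorem exists_cm_coboundary_witness_map (ha₁ : V.a₁ = 0) (ha₂ : V.a₂ = 0) (ha₃ : V.a₃ = 0)
    (ha₄ : V.a₄ = 0) [CharZero Ω] {ζ' : Ω} (hζ'3 : ζ' ^ 3 = 1) (hζ'1 : ζ' ≠ 1)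
    (P : (V.baseChange Ω).toAffine.Point) :
    ∃ Q : (V.baseChange Ω).toAffine.Point,
      (∀ s : Ω →ₐ[k] Ω, s ζ' = ζ' → Affine.Point.map (W' := V) s P = P →
          Affine.Point.map (W' := V) s Q = Q) ∧
      ∀ s : Ω →ₐ[k] Ω, s ζ' = ζ' ^ 2 → Affine.Point.map (W' := V) s P = -P →
          Affine.Point.map (W' := V) s Q - Q = P := by
  have hb₁ : (V.baseChange Ω).a₁ = 0 := by simp [WeierstrassCurve.baseChange, ha₁]
  have hb₂ : (V.baseChange Ω).a₂ = 0 := by simp [WeierstrassCurve.baseChange, ha₂]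
  have hb₃ : (V.baseChange Ω).a₃ = 0 := by simp [WeierstrassCurve.baseChange, ha₃]
  have hb₄ : (V.baseChange Ω).a₄ = 0 := by simp [WeierstrassCurve.baseChange, ha₄]
  have h2 : (2 : Ω) ≠ 0 := two_ne_zero
  rcases P with _ | ⟨x, y, h⟩
  · refine ⟨0, fun s _ _ ↦ map_zero _, fun s _ _ ↦ ?_⟩
    rw [map_zero, sub_zero]
    rfl
  · -- the rotated points are on the curve
    have h₂ : (V.baseChange Ω).toAffine.Nonsingular (ζ' ^ 2 * x) y := by
      simpa using nonsingular_cubeRoot_mul_map V ha₁ ha₂ ha₃ ha₄ hζ'3 h 2 1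
    have h₀' : (V.baseChange Ω).toAffine.Nonsingular x (-y) := by
      simpa using nonsingular_cubeRoot_mul_map V ha₁ ha₂ ha₃ ha₄ hζ'3 h 0 (-1)
    have h₁' : (V.baseChange Ω).toAffine.Nonsingular (ζ' * x) (-y) := by
      simpa using nonsingular_cubeRoot_mul_map V ha₁ ha₂ ha₃ ha₄ hζ'3 h 1 (-1)
    have h₂' : (V.baseChange Ω).toAffine.Nonsingular (ζ' ^ 2 * x) (-y) := by
      simpa using nonsingular_cubeRoot_mul_map V ha₁ ha₂ ha₃ ha₄ hζ'3 h 2 (-1)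
    refine ⟨Affine.Point.some (ζ' ^ 2 * x) y h₂, fun s hsζ hsP ↦ ?_, fun s hsζ hsP ↦ ?_⟩
    · -- (i) `s` fixes `ζ'` and `P`
      obtain ⟨h', e'⟩ := map_some_eq V s h
      obtain ⟨h'', e''⟩ := map_some_eq V s h₂
      have hxy : (Affine.Point.some _ _ h' : (V.baseChange Ω).toAffine.Point) =
          Affine.Point.some x y h := e'.symm.trans hsP
      rw [Affine.Point.some.injEq] at hxy
      exact e''.trans (Affine.Point.some_eq_some_of_eq (by rw [map_mul, map_pow, hsζ, hxy.1]) hxy.2)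
    · -- (ii) `s ζ' = ζ'²` and `s P = -P`
      obtain ⟨h', e'⟩ := map_some_eq V s h
      obtain ⟨h'', e''⟩ := map_some_eq V s h₂
      have hxy : (Affine.Point.some _ _ h' : (V.baseChange Ω).toAffine.Point) =
          Affine.Point.some x ((V.baseChange Ω).toAffine.negY x y)
            ((Affine.nonsingular_neg ..).mpr h) := e'.symm.trans hsP
      rw [Affine.Point.some.injEq] at hxy
      have hy : s y = -y := by
        rw [hxy.2]; simp [Affine.negY, ha₁, ha₃]
      -- `s Q = (ζ' x, -y)`
      have hsQ : Affine.Point.map (W' := V) s (Affine.Point.some (ζ' ^ 2 * x) y h₂) =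
          Affine.Point.some (ζ' * x) (-y) h₁' :=
        e''.trans (Affine.Point.some_eq_some_of_eq
          (by rw [map_mul, map_pow, hsζ, hxy.1, ← pow_mul]; linear_combination x * ζ' * hζ'3) hy)
      -- `-Q = (ζ'² x, -y)`
      have hnegQ : -(Affine.Point.some (ζ' ^ 2 * x) y h₂ : (V.baseChange Ω).toAffine.Point) =
          Affine.Point.some (ζ' ^ 2 * x) (-y) h₂' := by
        change Affine.Point.some (ζ' ^ 2 * x) ((V.baseChange Ω).toAffine.negY (ζ' ^ 2 * x) y) _ = _
        exact Affine.Point.some_eq_some_of_eq rfl (by simp [Affine.negY, ha₁, ha₃])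
      -- `P = -(x, -y)`
      have hP : -(Affine.Point.some x (-y) h₀' : (V.baseChange Ω).toAffine.Point) =
          Affine.Point.some x y h := by
        change Affine.Point.some x ((V.baseChange Ω).toAffine.negY x (-y)) _ = _
        exact Affine.Point.some_eq_some_of_eq rfl (by simp [Affine.negY, ha₁, ha₃])
      have key := horizontal_some_add_some_eq_neg hb₁ hb₂ hb₃ hb₄ h2 hζ'3 hζ'1 h₀' h₁' h₂'
      rw [sub_eq_add_neg, hsQ, hnegQ, ← hP]
      exact key

end MapWitness

end JZero

/-! ## §2 The embedded copy of `E'` in `Ē` and the subgroup `Γ_{E'} = galRange E' ≤ Γ_E` -/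

section EmbeddedCopy

variable {E : Type u} [Field E] (E' : Type u) [Field E'] [Algebra E E'] [Algebra.IsAlgebraic E E']

/-- Elements of `galRange E' = res(Γ_{E'}) ≤ Γ_E` fix the copy `j(E')` of `E'` inside `Ē` cut out
by the chosen isomorphism `e : Ē ≃ Ē'` (`j = e⁻¹ ∘ (E' → Ē')`); the tree's
`smul_embIntoClosure_of_mem_galRange`, for an arbitrary algebraic extension `E'/E` in place of an
extension of number fields. Serre, *Galois Cohomology*, II.§1.1. [folklore] -/
private theorem apply_eq_of_mem_galRange (j : E' →ₐ[E] AlgebraicClosure E)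
    (hj : ∀ x, algEquivOfEmb E' (closureEmb (K := E) E') (j x) =
      algebraMap E' (AlgebraicClosure E') x)
    {g : Field.absoluteGaloisGroup E} (hg : g ∈ galRange (K := E) E') (x : E') :
    (show AlgebraicClosure E ≃ₐ[E] AlgebraicClosure E from g) (j x) = j x := by
  obtain ⟨σ, rfl⟩ := hg
  apply (algEquivOfEmb E' (closureEmb (K := E) E')).injective
  change algEquivOfEmb E' (closureEmb (K := E) E')
      ((show AlgebraicClosure E ≃ₐ[E] AlgebraicClosure E from resGal (K := E) E' σ) _) = _
  rw [algEquivOfEmb_resGal_apply, hj, AlgEquiv.commutes]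

/-- Conversely, an element of `Γ_E` fixing the copy `j(E')` pointwise lies in `galRange E'`: it
extends through `e : Ē ≃ Ē'` to an `E'`-automorphism of `Ē'` restricting to it (the argument of the
tree's `finGalSubgroup_le_range_resGal`). Serre, *Galois Cohomology*, II.§1.1. [folklore] -/
private theorem mem_galRange_of_forall_apply_eq (j : E' →ₐ[E] AlgebraicClosure E)
    (hj : ∀ x, algEquivOfEmb E' (closureEmb (K := E) E') (j x) =
      algebraMap E' (AlgebraicClosure E') x)
    {g : Field.absoluteGaloisGroup E}
    (hg : ∀ x : E', (show AlgebraicClosure E ≃ₐ[E] AlgebraicClosure E from g) (j x) = j x) :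
    g ∈ galRange (K := E) E' := by
  let ι : AlgebraicClosure E →ₐ[E] AlgebraicClosure E' := closureEmb (K := E) E'
  let e : AlgebraicClosure E ≃ₐ[E] AlgebraicClosure E' := algEquivOfEmb E' ι
  let g' : AlgebraicClosure E ≃ₐ[E] AlgebraicClosure E := g
  let r : AlgebraicClosure E' ≃+* AlgebraicClosure E' :=
    (e.symm.toRingEquiv.trans g'.toRingEquiv).trans e.toRingEquiv
  have hr : ∀ z, r z = e (g' (e.symm z)) := fun z ↦ rfl
  have hrL : ∀ x : E', r (algebraMap E' (AlgebraicClosure E') x) =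
      algebraMap E' (AlgebraicClosure E') x := by
    intro x
    rw [hr]
    have h1 : e.symm (algebraMap E' (AlgebraicClosure E') x) = j x := by
      apply e.injective
      rw [AlgEquiv.apply_symm_apply]
      exact (hj x).symm
    rw [h1]
    change e ((show AlgebraicClosure E ≃ₐ[E] AlgebraicClosure E from g) (j x)) = _
    rw [hg x]
    exact hj x
  let σ : AlgebraicClosure E' ≃ₐ[E'] AlgebraicClosure E' := AlgEquiv.ofRingEquiv (f := r) hrL
  refine ⟨σ, ?_⟩
  apply AlgEquiv.ext
  intro z
  apply ι.injective
  change ι ((show AlgebraicClosure E ≃ₐ[E] AlgebraicClosure E from resGalAuxOfEmb ι σ) z) = ι (g' z)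
  rw [apply_resGalAuxOfEmb_apply]
  change r (ι z) = ι (g' z)
  rw [hr]
  have h2 : e.symm (ι z) = z := by
    rw [← algEquivOfEmb_apply E' ι z]
    exact e.symm_apply_apply z
  rw [h2]
  rfl

omit [Algebra.IsAlgebraic E E'] in
/-- Two primitive cube roots of unity `t, z` in a field satisfy `t = z` or `t = z²`
(`(t − z)(t − z²) = t² + t + 1 = 0`). [folklore] -/
private theorem eq_or_eq_sq_of_cube_eq_one {t z : E'} (ht3 : t ^ 3 = 1) (ht1 : t ≠ 1)
    (hz3 : z ^ 3 = 1) (hz1 : z ≠ 1) : t = z ∨ t = z ^ 2 := by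
  have ht : t ^ 2 + t + 1 = 0 := by
    have hprod : (t - 1) * (t ^ 2 + t + 1) = 0 := by linear_combination ht3
    rcases mul_eq_zero.mp hprod with h | h
    · exact absurd (sub_eq_zero.mp h) ht1
    · exact h
  have hz : z ^ 2 + z + 1 = 0 := by
    have hprod : (z - 1) * (z ^ 2 + z + 1) = 0 := by linear_combination hz3
    rcases mul_eq_zero.mp hprod with h | h
    · exact absurd (sub_eq_zero.mp h) hz1
    · exact h
  have hprod : (t - z) * (t - z ^ 2) = 0 := by
    linear_combination ht - t * hz + hz3
  rcases mul_eq_zero.mp hprod with h | h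
  · exact Or.inl (sub_eq_zero.mp h)
  · exact Or.inr (sub_eq_zero.mp h)

end EmbeddedCopy

/-! ## §3 Exact local descent along `E' = E(ζ₃) ⊇ E` for a `j = 0` short model -/

section LocalTower

variable {K : Type u} [Field K] (W : WeierstrassCurve K) [W.IsElliptic]
variable {E : Type u} [Field E] [Algebra K E] [CharZero E]
variable {E' : Type u} [Field E'] [Algebra K E'] [Algebra E E'] [IsScalarTower K E E']
  [FiniteDimensional E E']

/-- **Exact local descent.** `E = W/K` elliptic with all of `a₁, …, a₄` zero (`y² = x³ + B`),
`K → E → E'` a tower of `K`-fields (`char E = 0`, `E'/E` finite) with `E' = E + E ζ` for some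
`ζ ∈ E'` with `ζ² + ζ + 1 = 0`. Then a class `c ∈ H¹(K, E)` that dies in `H¹(E', E)` dies in
`H¹(E, E)`: `localRestrictionKer E' ≤ localRestrictionKer E` (the converse of the tree's
`localRestrictionKer_le_of_tower`, here without the factor `[E' : E]` of
`index_nsmul_mem_localRestrictionKer_of_tower`). Proof: the restriction to `E'` factors as
`H¹(K, E) → H¹(E, E) → H¹(E', E)` (`resGalOfEmb_comp_tower`), the kernel of the second map is
inflated from the open subgroup `N = galRange E'` of `Γ_E` (`resKer_le_range_inflClass`), which is
exactly the stabiliser of the embedded cube root `ζ'` (an element of `Γ_E` fixing `ζ'` fixes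
`E + E ζ'` and extends to `Γ_{E'}`), hence normal with `Γ_E = N ∪ N g₀` for any `g₀` with
`g₀ ζ' = ζ'²` (every element sends `ζ'` to `ζ'` or `ζ'²`); for an inflated crossed homomorphism
`f`, `P = f g₀` is `N`-fixed and `g₀ P = −P`, and `Q = [ω]P` is a coboundary witness
(`JZero.exists_cm_coboundary_witness_map`), so `[f] = 0`
(`inflClass_eq_zero_of_index_two_of_witness`); if no such `g₀` exists, `N = Γ_E` and `f = 0`.
Serre, *Galois Cohomology*, I.§2.4 and I.§5.8 (inflation–restriction), II.§1.1; Silverman, *AEC*,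
III.10.1. [cite: SerreGaloisCohomology1997, I.§2.4 (Prop. 9 and Cor.) and I.§5.8]
[cite: SilvermanAEC2009, Thm. III.10.1 and Cor. III.10.2] -/
theorem JZero.mem_localRestrictionKer_of_tower (ha₁ : W.a₁ = 0) (ha₂ : W.a₂ = 0) (ha₃ : W.a₃ = 0)
    (ha₄ : W.a₄ = 0) {ζ : E'} (hζ : ζ ^ 2 + ζ + 1 = 0)
    (hE' : ∀ x : E', ∃ a b : E, x = algebraMap E E' a + algebraMap E E' b * ζ)
    {c : W.galH1} (hc : c ∈ W.localRestrictionKer E') : c ∈ W.localRestrictionKer E := by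
  haveI : Algebra.IsAlgebraic E E' := Algebra.IsAlgebraic.of_finite E E'
  haveI : CharZero E' := charZero_of_injective_algebraMap (algebraMap E E').injective
  haveI : CharZero (AlgebraicClosure E) :=
    charZero_of_injective_algebraMap (algebraMap E (AlgebraicClosure E)).injective
  let ι₁ : AlgebraicClosure K →ₐ[K] AlgebraicClosure E := closureEmb (K := K) E
  let ι₂ : AlgebraicClosure E →ₐ[E] AlgebraicClosure E' := closureEmb (K := E) E'
  -- Step 1: `hc` as membership of `res_E c` in the kernel of the middle restriction
  rw [← WeierstrassCurve.localRestrictionKerOfEmb_eq_holds W E' ((ι₂.restrictScalars K).comp ι₁)]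
    at hc
  change c ∈ resKer (resGalOfEmb ((ι₂.restrictScalars K).comp ι₁))
    (pointsMapOfEmb W ((ι₂.restrictScalars K).comp ι₁)) (pointsMapOfEmb_smul W _) at hc
  rw [resKer_eq_ker, AddMonoidHom.mem_ker,
    resH1Hom_congr (resGalOfEmb_comp_tower ι₁ ι₂) (pointsMapOfEmb_comp_tower W ι₁ ι₂) _
      (fun x m ↦ by
        simp only [ContinuousMonoidHom.comp_toFun, AddMonoidHom.coe_comp, Function.comp_apply,
          pointsMapOfEmb_smul, pointsMapTower_smul]),
    ← resH1Hom_comp (resGalOfEmb ι₁) (pointsMapOfEmb W ι₁) (pointsMapOfEmb_smul W ι₁)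
      (resGalOfEmb (K := E) ι₂) _ (pointsMapTower_smul W ι₂), AddMonoidHom.comp_apply,
    ← AddMonoidHom.mem_ker, ← resKer_eq_ker] at hc
  -- Step 2: the middle kernel is inflated from the open subgroup `N = galRange E'`
  have hN : IsOpen (galRange (K := E) E' : Set (Field.absoluteGaloisGroup E)) :=
    Subgroup.isOpen_mono (finGalSubgroup_le_range_resGal E') (isOpen_finGalSubgroup E')
  obtain ⟨f, hf⟩ := resKer_le_range_inflClass (resGalOfEmb (K := E) ι₂) (pointsMapTower W ι₂)
    (pointsMapTower_smul W ι₂) (pointsMapTower_bijective W ι₂) (galRange (K := E) E') hN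
    (fun _ h ↦ h) hc
  suffices h0 : inflClass (localPoints W E) (galRange (K := E) E') hN f = 0 by
    change resH1Hom (resGalOfEmb ι₁) (pointsMapOfEmb W ι₁) (pointsMapOfEmb_smul W ι₁) c = 0
    rw [← hf, h0]
  -- Step 3: the embedded copy `j : E' → Ē` and the embedded cube root `ζ' = j ζ`
  let e : AlgebraicClosure E ≃ₐ[E] AlgebraicClosure E' := algEquivOfEmb E' ι₂
  let j : E' →ₐ[E] AlgebraicClosure E :=
    (e.symm : AlgebraicClosure E' →ₐ[E] AlgebraicClosure E).comp
      (IsScalarTower.toAlgHom E E' (AlgebraicClosure E'))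
  have hj : ∀ x, algEquivOfEmb E' (closureEmb (K := E) E') (j x) =
      algebraMap E' (AlgebraicClosure E') x := fun x ↦ e.apply_symm_apply _
  obtain ⟨ζ', hζ'⟩ : ∃ ζ' : AlgebraicClosure E, j ζ = ζ' := ⟨_, rfl⟩
  have hζ3 : ζ ^ 3 = 1 := by linear_combination (ζ - 1) * hζ
  have hζ1 : ζ ≠ 1 := by
    rintro rfl
    norm_num at hζ
  have hζ'3 : ζ' ^ 3 = 1 := by rw [← hζ', ← map_pow, hζ3, map_one]
  have hζ'1 : ζ' ≠ 1 := by
    intro h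
    apply hζ1
    apply j.injective
    change j ζ = j 1
    rw [hζ', h, map_one]
  have hζ'0 : ζ' ≠ 0 := fun h ↦ by
    rw [h] at hζ'3
    norm_num at hζ'3
  have hζ'sq : ζ' ^ 2 ≠ ζ' := fun h ↦ by
    have : ζ' * (ζ' - 1) = 0 := by linear_combination h
    rcases mul_eq_zero.mp this with h0 | h0
    · exact hζ'0 h0
    · exact hζ'1 (sub_eq_zero.mp h0)
  have hζ'4 : (ζ' ^ 2) ^ 2 = ζ' := by linear_combination ζ' * hζ'3
  -- the action of `Γ_E` on `ζ'`
  obtain ⟨act, hact⟩ : ∃ act : Field.absoluteGaloisGroup E → AlgebraicClosure E,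
      ∀ g, act g = (show AlgebraicClosure E ≃ₐ[E] AlgebraicClosure E from g) ζ' :=
    ⟨_, fun _ ↦ rfl⟩
  have act_mul : ∀ a b : Field.absoluteGaloisGroup E,
      act (a * b) = (show AlgebraicClosure E ≃ₐ[E] AlgebraicClosure E from a) (act b) :=
    fun a b ↦ by rw [hact, hact]; rfl
  have act_one : act 1 = ζ' := by rw [hact]; rfl
  -- `N` is the stabiliser of `ζ'`
  have hfixN : ∀ n ∈ galRange (K := E) E', act n = ζ' := fun n hn ↦ by
    rw [hact, ← hζ']
    exact apply_eq_of_mem_galRange E' j hj hn ζ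
  have hmemN : ∀ g : Field.absoluteGaloisGroup E, act g = ζ' → g ∈ galRange (K := E) E' :=
      fun g hg ↦ by
    rw [hact] at hg
    refine mem_galRange_of_forall_apply_eq E' j hj fun x ↦ ?_
    obtain ⟨a, b, rfl⟩ := hE' x
    rw [map_add, map_mul, AlgHom.commutes, AlgHom.commutes, hζ', map_add, map_mul,
      AlgEquiv.commutes, AlgEquiv.commutes, hg]
  -- every element of `Γ_E` sends `ζ'` to `ζ'` or to `ζ'²`
  have hdich : ∀ g : Field.absoluteGaloisGroup E, act g = ζ' ∨ act g = ζ' ^ 2 := fun g ↦ by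
    rw [hact]
    refine eq_or_eq_sq_of_cube_eq_one (AlgebraicClosure E) ?_ ?_ hζ'3 hζ'1
    · rw [← map_pow, hζ'3, map_one]
    · intro h
      exact hζ'1 ((show AlgebraicClosure E ≃ₐ[E] AlgebraicClosure E from g).injective
        (h.trans (map_one _).symm))
  have act_mul_of_eq : ∀ a b : Field.absoluteGaloisGroup E, act b = ζ' → act (a * b) = act a :=
    fun a b hb ↦ by rw [act_mul, hb, hact]
  have act_mul_of_eq_sq : ∀ a b : Field.absoluteGaloisGroup E, act b = ζ' ^ 2 →
      act (a * b) = act a ^ 2 := fun a b hb ↦ by rw [act_mul, hb, map_pow, hact]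
  -- the inverse of an element acts on `ζ'` like the element itself
  have hinv : ∀ g : Field.absoluteGaloisGroup E, act g⁻¹ = act g := fun g ↦ by
    have h1 : act (g * g⁻¹) = ζ' := by rw [mul_inv_cancel, act_one]
    rcases hdich g with hg | hg <;> rcases hdich g⁻¹ with hg' | hg'
    · rw [hg, hg']
    · rw [act_mul_of_eq_sq g g⁻¹ hg', hg] at h1
      exact absurd h1 hζ'sq
    · rw [act_mul_of_eq g g⁻¹ hg', hg] at h1
      exact absurd h1 hζ'sq
    · rw [hg, hg']
  -- `N` is normal
  haveI hNn : (galRange (K := E) E').Normal := by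
    refine ⟨fun n hn g ↦ hmemN _ ?_⟩
    rcases hdich g with hg | hg
    · rw [act_mul_of_eq _ _ ((hinv g).trans hg), act_mul_of_eq _ _ (hfixN n hn), hg]
    · rw [act_mul_of_eq_sq _ _ ((hinv g).trans hg), act_mul_of_eq _ _ (hfixN n hn), hg, hζ'4]
  -- Step 4: kill `[f]`
  by_cases hex : ∃ g₀ : Field.absoluteGaloisGroup E, act g₀ = ζ' ^ 2
  · obtain ⟨g₀, hg₀⟩ := hex
    have hcoset : ∀ g : Field.absoluteGaloisGroup E,
        g ∈ galRange (K := E) E' ∨ g * g₀⁻¹ ∈ galRange (K := E) E' := fun g ↦ by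
      rcases hdich g with hg | hg
      · exact Or.inl (hmemN g hg)
      · refine Or.inr (hmemN _ ?_)
        rw [act_mul_of_eq_sq _ _ ((hinv g₀).trans hg₀), hg, hζ'4]
    have hg₀2 : g₀ * g₀ ∈ galRange (K := E) E' :=
      hmemN _ (by rw [act_mul_of_eq_sq _ _ hg₀, hg₀, hζ'4])
    -- `P := f g₀` is fixed by `N` and flipped by `g₀`
    have hPflip : g₀ • f.1 g₀ = -f.1 g₀ := by
      have e₀ := cocyclesVanishingOn.cocycle f g₀ g₀
      rw [cocyclesVanishingOn.apply_of_mem f hg₀2] at e₀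
      exact eq_neg_of_add_eq_zero_right e₀.symm
    obtain ⟨Q, hQfix, hQmove⟩ := JZero.exists_cm_coboundary_witness_map W ha₁ ha₂ ha₃ ha₄
      (Ω := AlgebraicClosure E) hζ'3 hζ'1
      (show (W.baseChange (AlgebraicClosure E)).toAffine.Point from f.1 g₀)
    refine inflClass_eq_zero_of_index_two_of_witness (galRange (K := E) E') hN f hcoset
      (show localPoints W E from Q) (fun n hn ↦ ?_) ?_
    · rw [localPoints.smul_def]
      refine hQfix _ ?_ ?_
      · have h := hfixN n hn
        rw [hact] at h
        exact h
      · rw [← localPoints.smul_def]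
        exact cocyclesVanishingOn.smul_apply f g₀ hn
    · rw [localPoints.smul_def]
      refine hQmove _ ?_ ?_
      · rw [hact] at hg₀
        exact hg₀
      · rw [← localPoints.smul_def]
        exact hPflip
  · -- no element acts by `ζ' ↦ ζ'²`: `N = Γ_E` and `f = 0`
    simp only [not_exists] at hex
    have hall : ∀ g : Field.absoluteGaloisGroup E, g ∈ galRange (K := E) E' := fun g ↦
      hmemN g ((hdich g).resolve_right (hex g))
    refine inflClass_eq_zero_of_index_two_of_witness (galRange (K := E) E') hN f (g₀ := 1)
      (fun g ↦ Or.inl (hall g)) 0 (fun n _ ↦ smul_zero n) ?_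
    rw [smul_zero, sub_zero, cocyclesVanishingOn.apply_of_mem f (Subgroup.one_mem _)]

/-- **Exact local descent, binder form for `[E' : E] ≤ 2` generated by a cube root of unity**:
`localRestrictionKer E' = localRestrictionKer E` (as the tree's `localRestrictionKer_le_of_tower`
gives the other inclusion). [cite: SerreGaloisCohomology1997, I.§2.4 (Prop. 9 and Cor.) and I.§5.8] -/
theorem JZero.localRestrictionKer_eq_of_tower (ha₁ : W.a₁ = 0) (ha₂ : W.a₂ = 0) (ha₃ : W.a₃ = 0)
    (ha₄ : W.a₄ = 0) {ζ : E'} (hζ : ζ ^ 2 + ζ + 1 = 0)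
    (hE' : ∀ x : E', ∃ a b : E, x = algebraMap E E' a + algebraMap E E' b * ζ) :
    W.localRestrictionKer E' = W.localRestrictionKer E :=
  le_antisymm (fun _ hc ↦ JZero.mem_localRestrictionKer_of_tower W ha₁ ha₂ ha₃ ha₄ hζ hE' hc)
    (localRestrictionKer_le_of_tower W)

end LocalTower

/-! ## §4 Number fields `L = K + K ω ⊇ K`: `res x ∈ Ш(E_L/L) ⇒ x ∈ Ш(E/K)` -/

section NumberField

open NumberField IsDedekindDomain Literature.NumberTheory.QuadraticFields

variable {K : Type u} [Field K] [NumberField K] (W : WeierstrassCurve K) [W.IsElliptic]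
variable (L : Type u) [Field L] [NumberField L] [Algebra K L]

/-- **`L_w = K_v + K_v ω` at a finite place `w ∣ v`** when `L = K + K ω`: the `K_v`-span of
`1, ω` in `L_w` is finite-dimensional, hence closed (`Submodule.closed_of_finiteDimensional`), and
contains the dense image of `L` (`HeightOneSpectrum.denseRange_algebraMap`), so it is everything
(the argument of Mathlib's `Module.Finite K_v L_w` and of the tree's `finrank_adicCompletion_le`).
[folklore] -/
private theorem exists_eq_add_mul_adicCompletion {ω : L}
    (hL : ∀ x : L, ∃ a b : K, x = algebraMap K L a + algebraMap K L b * ω)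
    (v : HeightOneSpectrum (𝓞 K)) (w : HeightOneSpectrum (𝓞 L)) [w.asIdeal.LiesOver v.asIdeal]
    (y : w.adicCompletion L) :
    ∃ a b : v.adicCompletion K, y = adicCompletionMap (K := K) L v w a +
      adicCompletionMap (K := K) L v w b * algebraMap L (w.adicCompletion L) ω := by
  have hcont : Continuous (adicCompletionMap (K := K) L v w) := by
    unfold adicCompletionMap
    exact (HeightOneSpectrum.adicCompletion.continuous_ofCompletion L w).comp
      ((UniformSpace.Completion.continuous_map).comp
        (HeightOneSpectrum.adicCompletion.continuous_toCompletion K v))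
  have hcoe : ∀ x : K, adicCompletionMap (K := K) L v w (algebraMap K (v.adicCompletion K) x) =
      algebraMap L (w.adicCompletion L) (algebraMap K L x) := fun x ↦
    adicCompletionMap_coe (K := K) L v w x
  letI : Algebra (v.adicCompletion K) (w.adicCompletion L) :=
    (adicCompletionMap (K := K) L v w).toAlgebra
  haveI : ContinuousSMul (v.adicCompletion K) (w.adicCompletion L) :=
    ⟨(hcont.comp continuous_fst).mul continuous_snd⟩
  -- the closed subspace `S = K_v + K_v ω`
  let S : Submodule (v.adicCompletion K) (w.adicCompletion L) :=
    Submodule.span (v.adicCompletion K) {1, algebraMap L (w.adicCompletion L) ω}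
  haveI : FiniteDimensional (v.adicCompletion K) S :=
    FiniteDimensional.span_of_finite _ ((Set.finite_singleton _).insert _)
  have hSclosed : IsClosed (S : Set (w.adicCompletion L)) := by
    -- `K_v` as a nontrivially normed field (Mathlib's `Valued.toNontriviallyNormedField`, scoped)
    open scoped Valued in exact S.closed_of_finiteDimensional
  -- `S` contains the dense image of `L`
  have h1 : (1 : w.adicCompletion L) ∈ S := Submodule.subset_span (Set.mem_insert _ _)
  have hω : algebraMap L (w.adicCompletion L) ω ∈ S :=
    Submodule.subset_span (Set.mem_insert_of_mem _ (Set.mem_singleton _))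
  have hKS : ∀ a : K, algebraMap L (w.adicCompletion L) (algebraMap K L a) =
      algebraMap K (v.adicCompletion K) a • (1 : w.adicCompletion L) := fun a ↦ by
    rw [Algebra.smul_def, mul_one, RingHom.algebraMap_toAlgebra, hcoe]
  have hLS : Set.range (algebraMap L (w.adicCompletion L)) ⊆ S := by
    rintro _ ⟨l, rfl⟩
    obtain ⟨a, b, rfl⟩ := hL l
    rw [map_add, map_mul, hKS a, hKS b, smul_mul_assoc, one_mul]
    exact S.add_mem (S.smul_mem _ h1) (S.smul_mem _ hω)
  have hSuniv : (S : Set (w.adicCompletion L)) = Set.univ := by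
    apply Set.eq_univ_of_univ_subset
    rw [← (HeightOneSpectrum.denseRange_algebraMap L w).closure_range]
    exact closure_minimal hLS hSclosed
  have hy : y ∈ S := by
    rw [← SetLike.mem_coe, hSuniv]
    exact Set.mem_univ y
  obtain ⟨a, b, hab⟩ := Submodule.mem_span_pair.mp hy
  refine ⟨a, b, ?_⟩
  rw [← hab, Algebra.smul_def, Algebra.smul_def, mul_one, RingHom.algebraMap_toAlgebra]

omit [NumberField K] [NumberField L] in
/-- **`L_w = K_v + K_v ω` at an infinite place `w ∣ v`** for `ω² + ω + 1 = 0`: either `w` is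
unramified over `K` and `L_w = K_v` (Mathlib `finrank_eq_one_of_isUnramified`), or `w` is ramified,
`v` is real and `K_v ≅ ℝ` contains no root of `t² + t + 1`, so `1, ω` is a `K_v`-basis of the
quadratic extension `L_w/K_v` (Mathlib `finrank_eq_two_of_isRamified`). [folklore] -/
private theorem exists_eq_add_mul_completion {ω : L} (hω : ω ^ 2 + ω + 1 = 0)
    (v : InfinitePlace K) (w : InfinitePlace L) [w.1.LiesOver v.1] :
    letI : Algebra v.Completion w.Completion := NumberField.LiesOver.instAlgebraCompletion
    ∀ y : w.Completion, ∃ a b : v.Completion,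
      y = algebraMap v.Completion w.Completion a +
        algebraMap v.Completion w.Completion b * algebraMap L w.Completion ω := by
  letI : Algebra v.Completion w.Completion := NumberField.LiesOver.instAlgebraCompletion
  obtain ⟨hfin, -⟩ := finrank_completion_le_two (K := K) L v w
  haveI : FiniteDimensional v.Completion w.Completion := hfin
  intro y
  by_cases hun : w.IsUnramified K
  · -- degree `1`: `L_w = K_v`
    have h1 := InfinitePlace.Completion.finrank_eq_one_of_isUnramified v hun
    have hy : y ∈ (⊤ : Subalgebra v.Completion w.Completion) := Algebra.mem_top
    rw [← Subalgebra.bot_eq_top_of_finrank_eq_one h1, Algebra.mem_bot] at hy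
    obtain ⟨a, rfl⟩ := hy
    exact ⟨a, 0, by rw [map_zero, zero_mul, add_zero]⟩
  · -- degree `2` over `K_v ≅ ℝ`, which has no primitive cube root of unity
    have h2 := InfinitePlace.Completion.finrank_eq_two_of_isRamified v hun
    have hv : v.IsReal := InfinitePlace.IsRamified.liesOver_isReal_under (w := w) (v := v) hun
    have hnot : algebraMap L w.Completion ω ∉ Set.range (algebraMap v.Completion w.Completion) := by
      rintro ⟨r, hr⟩
      have hr2 : r ^ 2 + r + 1 = 0 := by
        apply (algebraMap v.Completion w.Completion).injective
        rw [map_add, map_add, map_pow, map_one, map_zero, hr, ← map_pow, ← map_one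
          (algebraMap L w.Completion), ← map_add, ← map_add, hω, map_zero]
      have hs : (InfinitePlace.Completion.ringEquivRealOfIsReal hv r) ^ 2 +
          InfinitePlace.Completion.ringEquivRealOfIsReal hv r + 1 = 0 := by
        rw [← map_pow, ← map_one (InfinitePlace.Completion.ringEquivRealOfIsReal hv), ← map_add,
          ← map_add, hr2, map_zero]
      nlinarith [sq_nonneg (2 * InfinitePlace.Completion.ringEquivRealOfIsReal hv r + 1)]
    exact Quadratic.exists_eq_add_mul h2 hnot y

/-- **EXACT LOCAL DESCENT of `Ш` along `L = K(ω) ⊇ K` for a `j = 0` short model.** `E = W/K`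
elliptic over a number field `K` with all of `a₁, …, a₄` zero (`y² = x³ + B`), `L = K + K ω` a
number field with `ω² + ω + 1 = 0` (`L = K` or `L = K(√−3)`). If the restriction
`res x ∈ H¹(L, E_L)` of a class `x ∈ H¹(K, E)` lies in `Ш(E_L/L)`, then `x ∈ Ш(E/K)`: at a place `v`
of `K` pick `w ∣ v`; `res x` dies in `H¹(L_w, E_L)`, i.e. `x` dies in `H¹(L_w, E)`
(`mem_localRestrictionKer_iff_resBaseChange_mem`), hence in `H¹(K_v, E)` by the exact local descent
`JZero.mem_localRestrictionKer_of_tower` along `L_w = K_v + K_v ω`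
(`exists_eq_add_mul_adicCompletion`, `exists_eq_add_mul_completion`). This sharpens the tree's
`two_nsmul_mem_sha_of_resBaseChange_mem_sha` (`2x ∈ Ш(E/K)`, any quadratic `L/K`) in the CM frame:
the local terms `H¹(Gal(L_w/K_v), E(L_w))` of Dokchitser–Dokchitser's "cokernel killed by `|G|²`"
vanish. Serre, *Galois Cohomology*, I.§2.4, I.§5.8; Dokchitser–Dokchitser, Ann. of Math. 172
(2010), Lemma 4.14 (proof); cf. Gross 1991 §5 (5.1) for the Heegner analogue.
[cite: DokchitserDokchitserAnnals2010, Lemma 4.14 (proof)]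
[cite: SerreGaloisCohomology1997, I.§2.4 (Prop. 9 and Cor.) and I.§5.8] -/
theorem JZero.mem_sha_of_resBaseChange_mem_sha (ha₁ : W.a₁ = 0) (ha₂ : W.a₂ = 0) (ha₃ : W.a₃ = 0)
    (ha₄ : W.a₄ = 0) {ω : L} (hω : ω ^ 2 + ω + 1 = 0)
    (hL : ∀ x : L, ∃ a b : K, x = algebraMap K L a + algebraMap K L b * ω) {x : W.galH1}
    (hx : resBaseChange W L x ∈ (W.baseChange L).sha) : x ∈ W.sha := by
  rw [WeierstrassCurve.mem_sha_iff] at hx ⊢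
  refine ⟨fun v ↦ ?_, fun v ↦ ?_⟩
  · -- finite places
    obtain ⟨w, hw⟩ := exists_liesOver L v
    haveI := hw
    obtain ⟨hfin, -⟩ := finrank_adicCompletion_le_of_liesOver L v w
    letI : Algebra (v.adicCompletion K) (w.adicCompletion L) :=
      (adicCompletionMap (K := K) L v w).toAlgebra
    haveI : IsScalarTower K (v.adicCompletion K) (w.adicCompletion L) :=
      IsScalarTower.of_algebraMap_eq fun x ↦ (adicCompletionMap_coe (K := K) L v w x).symm
    haveI : FiniteDimensional (v.adicCompletion K) (w.adicCompletion L) := hfin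
    haveI : CharZero (v.adicCompletion K) :=
      charZero_of_injective_algebraMap (algebraMap K (v.adicCompletion K)).injective
    have hx' : x ∈ W.localRestrictionKer (w.adicCompletion L) :=
      (mem_localRestrictionKer_iff_resBaseChange_mem W x).mpr (hx.1 w)
    have hζ : (algebraMap L (w.adicCompletion L) ω) ^ 2 + algebraMap L (w.adicCompletion L) ω + 1 =
        0 := by
      rw [← map_pow, ← map_one (algebraMap L (w.adicCompletion L)), ← map_add, ← map_add, hω,
        map_zero]
    exact JZero.mem_localRestrictionKer_of_tower W (E := v.adicCompletion K) ha₁ ha₂ ha₃ ha₄ hζ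
      (exists_eq_add_mul_adicCompletion L hL v w) hx'
  · -- infinite places
    obtain ⟨w, hw⟩ := InfinitePlace.comap_surjective (k := K) (K := L) v
    subst hw
    set v : InfinitePlace K := w.comap (algebraMap K L)
    haveI : w.1.LiesOver v.1 := ⟨rfl⟩
    obtain ⟨hfin, -⟩ := finrank_completion_le_two (K := K) L v w
    haveI : IsScalarTower K L w.Completion := IsScalarTower.of_algebraMap_eq fun x ↦ by
      apply NumberField.InfinitePlace.Completion.ext
      rw [NumberField.InfinitePlace.Completion.algebraMap_toCompletion,
        NumberField.InfinitePlace.Completion.algebraMap_toCompletion,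
        UniformSpace.Completion.algebraMap_def, UniformSpace.Completion.algebraMap_def,
        IsScalarTower.algebraMap_apply K L (WithAbs w.1)]
    letI : Algebra v.Completion w.Completion := NumberField.LiesOver.instAlgebraCompletion
    haveI : IsScalarTower K v.Completion w.Completion :=
      NumberField.LiesOver.instIsScalarTowerCompletion
    haveI : FiniteDimensional v.Completion w.Completion := hfin
    haveI : CharZero v.Completion :=
      charZero_of_injective_algebraMap (algebraMap K v.Completion).injective
    have hx' : x ∈ W.localRestrictionKer w.Completion :=
      (mem_localRestrictionKer_iff_resBaseChange_mem W x).mpr (hx.2 w)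
    have hζ : (algebraMap L w.Completion ω) ^ 2 + algebraMap L w.Completion ω + 1 = 0 := by
      rw [← map_pow, ← map_one (algebraMap L w.Completion), ← map_add, ← map_add, hω, map_zero]
    exact JZero.mem_localRestrictionKer_of_tower W (E := v.Completion) ha₁ ha₂ ha₃ ha₄ hζ
      (exists_eq_add_mul_completion L hω v w) hx'

/-- **`x ∈ Ш(E/K) ⇔ res x ∈ Ш(E_L/L)`** for `L = K + K ω` and a `j = 0` short model: the tree's
`resBaseChange_mem_sha` and `JZero.mem_sha_of_resBaseChange_mem_sha`.
[cite: DokchitserDokchitserAnnals2010, Lemma 4.14 (proof)]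
[cite: SerreGaloisCohomology1997, I.§2.4 (Prop. 9 and Cor.) and I.§5.8] -/
theorem JZero.mem_sha_iff_resBaseChange_mem_sha (ha₁ : W.a₁ = 0) (ha₂ : W.a₂ = 0)
    (ha₃ : W.a₃ = 0) (ha₄ : W.a₄ = 0) {ω : L} (hω : ω ^ 2 + ω + 1 = 0)
    (hL : ∀ x : L, ∃ a b : K, x = algebraMap K L a + algebraMap K L b * ω) (x : W.galH1) :
    x ∈ W.sha ↔ resBaseChange W L x ∈ (W.baseChange L).sha :=
  ⟨resBaseChange_mem_sha W L,
    fun hx ↦ JZero.mem_sha_of_resBaseChange_mem_sha W L ha₁ ha₂ ha₃ ha₄ hω hL hx⟩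

/-- **`Ш(E/K) = res⁻¹ Ш(E_L/L)`** as subgroups of `H¹(K, E)`, for `L = K + K ω` and a `j = 0`
short model. [cite: DokchitserDokchitserAnnals2010, Lemma 4.14 (proof)]
[cite: SerreGaloisCohomology1997, I.§2.4 (Prop. 9 and Cor.) and I.§5.8] -/
theorem JZero.sha_eq_comap_resBaseChange (ha₁ : W.a₁ = 0) (ha₂ : W.a₂ = 0) (ha₃ : W.a₃ = 0)
    (ha₄ : W.a₄ = 0) {ω : L} (hω : ω ^ 2 + ω + 1 = 0)
    (hL : ∀ x : L, ∃ a b : K, x = algebraMap K L a + algebraMap K L b * ω) :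
    W.sha = ((W.baseChange L).sha).comap (resBaseChange W L) := by
  ext x
  rw [AddSubgroup.mem_comap]
  exact JZero.mem_sha_iff_resBaseChange_mem_sha W L ha₁ ha₂ ha₃ ha₄ hω hL x

/-- **Selmer version: `res η ∈ Sel_{p^∞}(E_L/L) ⇒ η ∈ Sel_{p^∞}(E/K)`** for `L = K + K ω`, a
`j = 0` short model and any prime power torsion `p^∞` (any map `r` on `H¹(K, E[p^∞])` covering the
restriction `H¹(K, E) → H¹(L, E_L)`, e.g. the tree's restriction of `SelmerPInftyRestriction`): the
Selmer groups are the preimages of `Ш` (`selmerGroupPInfty_eq_comap_sha`). Sharpens the tree's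
`two_nsmul_mem_selmerGroupPInfty_of_res_mem`. [cite: DokchitserDokchitserAnnals2010, Lemma 4.14 (proof)]
[cite: SerreGaloisCohomology1997, I.§2.4 (Prop. 9 and Cor.) and I.§5.8] -/
theorem JZero.mem_selmerGroupPInfty_of_res_mem (ha₁ : W.a₁ = 0) (ha₂ : W.a₂ = 0) (ha₃ : W.a₃ = 0)
    (ha₄ : W.a₄ = 0) {ω : L} (hω : ω ^ 2 + ω + 1 = 0)
    (hL : ∀ x : L, ∃ a b : K, x = algebraMap K L a + algebraMap K L b * ω) (p : ℕ)
    (r : galH1Primary W p →+ galH1Primary (W.baseChange L) p)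
    (hr : ∀ η, primaryH1ToH1 (W.baseChange L) p (r η) = resBaseChange W L (primaryH1ToH1 W p η))
    {η : galH1Primary W p} (hη : r η ∈ selmerGroupPInfty (W.baseChange L) p) :
    η ∈ selmerGroupPInfty W p := by
  rw [selmerGroupPInfty_eq_comap_sha, AddSubgroup.mem_comap] at hη ⊢
  rw [hr] at hη
  exact JZero.mem_sha_of_resBaseChange_mem_sha W L ha₁ ha₂ ha₃ ha₄ hω hL hη

/-- **The cube-sum frame `K = ℚ(√−3) ⊇ ℚ`: `res x ∈ Ш(E_K/K) ⇒ x ∈ Ш(E/ℚ)`** for `E : y² = x³ + B`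
over `ℚ` and `K` a quadratic number field containing `ω` with `ω² + ω + 1 = 0` (then `K = ℚ + ℚ ω`,
`Quadratic.exists_eq_add_mul`, as `ω ∉ ℚ`). With `JZero.shaRestriction_injective`
(`ShaRestrictionJZeroDescent`): `Ш(E/ℚ) ≅ res(H¹(ℚ, E)) ∩ Ш(E_K/K)`.
[cite: DokchitserDokchitserAnnals2010, Lemma 4.14 (proof)]
[cite: SerreGaloisCohomology1997, I.§2.4 (Prop. 9 and Cor.) and I.§5.8] -/
theorem JZero.mem_sha_of_resBaseChange_mem_sha_rat (W : WeierstrassCurve ℚ) [W.IsElliptic]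
    (ha₁ : W.a₁ = 0) (ha₂ : W.a₂ = 0) (ha₃ : W.a₃ = 0) (ha₄ : W.a₄ = 0) (K : Type) [Field K]
    [NumberField K] {ω : K} (hω : ω ^ 2 + ω + 1 = 0) (h2 : Module.finrank ℚ K = 2)
    {x : W.galH1} (hx : resBaseChange W K x ∈ (W.baseChange K).sha) : x ∈ W.sha := by
  have hnot : ω ∉ Set.range (algebraMap ℚ K) := by
    rintro ⟨q, hq⟩
    have hq2 : q ^ 2 + q + 1 = 0 := by
      apply (algebraMap ℚ K).injective
      rw [map_add, map_add, map_pow, map_one, map_zero, hq, hω]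
    nlinarith [sq_nonneg (2 * q + 1)]
  exact JZero.mem_sha_of_resBaseChange_mem_sha W K ha₁ ha₂ ha₃ ha₄ hω
    (Quadratic.exists_eq_add_mul h2 hnot) hx

/-- **`x ∈ Ш(E/ℚ) ⇔ res x ∈ Ш(E_K/K)`** in the cube-sum frame (`K ⊇ ℚ` quadratic with
`ω² + ω + 1 = 0`, `E : y² = x³ + B`). [cite: DokchitserDokchitserAnnals2010, Lemma 4.14 (proof)]
[cite: SerreGaloisCohomology1997, I.§2.4 (Prop. 9 and Cor.) and I.§5.8] -/
theorem JZero.mem_sha_iff_resBaseChange_mem_sha_rat (W : WeierstrassCurve ℚ) [W.IsElliptic]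
    (ha₁ : W.a₁ = 0) (ha₂ : W.a₂ = 0) (ha₃ : W.a₃ = 0) (ha₄ : W.a₄ = 0) (K : Type) [Field K]
    [NumberField K] {ω : K} (hω : ω ^ 2 + ω + 1 = 0) (h2 : Module.finrank ℚ K = 2)
    (x : W.galH1) : x ∈ W.sha ↔ resBaseChange W K x ∈ (W.baseChange K).sha :=
  ⟨resBaseChange_mem_sha W K,
    fun hx ↦ JZero.mem_sha_of_resBaseChange_mem_sha_rat W ha₁ ha₂ ha₃ ha₄ K hω h2 hx⟩

end NumberField

end Literature.NumberTheory.EllipticCurves
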